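import Summits.AtomisticToContinuum.FouriersLaw.Theorems.PhononMeanFreePathIncoherentChannelTailBudget

/-!
# The coherent budget of the forecast is non-increasing in time

Route `PhononMeanFreePath` (sub-problem `FouriersLaw`), crux `IncoherentChannel` (stmt-AtomisticToContinuum-11811), line
`two-horizons-forecast-loss`, lead c7 (registered helper stub `coherentBudget_antitone`; `--supports`, nothing here closes an item).

For the `(N+1)`-site pinned chain `pinnedChain ω₂ lam β γ` (`ω₂, β, γ > 0`, `lam ≥ 0`) with both Langevin baths at `T > 0`, the
forecast norm `S_N = fnorm`, the coherent channel `r_N = pairCorr` and the echo `a_N(s) = ⟨p_N, K_s p_N⟩_{μ₀}`: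
the COHERENT BUDGET `B_N(t) := S_N(t) + (2γ/T)∫_{(0,t]}(r_N² + a_N²)` is NON-INCREASING in `t ≥ 0`, for every `N`
(`coherentBudget_antitone`). This is the finite-window form of the landed budgets (`forecastBudget_timeResolved`, p136614:
`B_N(t) ≤ B_N(0) = T`; `forecastBudget_tail`, p148747: the window `(t₁, ∞)`) with the forecast-norm term KEPT: the `L²(μ₀)` budget
`forecastBudget_timeResolved_of_sq_integrable'` at `F = v_{t₁}`, Chapman–Kolmogorov `K_s v_{t₁} = v_{s+t₁}`
(`timeReversal_fcast_add`), finiteness of the shifted lower integral, and the translation `s ↦ s + t₁` on the time axis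
(`intervalIntegral.integral_comp_add_right`). At `lam = β = 0` the budget is CONSTANT (`= T`, dissipation identity p155138); the
lead's `anharmonicShortTimeLoss` makes it drop by `c t⁵` at short times for `lam, β > 0`, and monotonicity carries the defect to all
later times. No definition, no `sorry`, standard axioms.
-/

noncomputable section

namespace Summit.AtomisticToContinuum.FouriersLaw.Theorems.PhononMeanFreePath

open MeasureTheory ProbabilityTheory Filter Topology Set intervalIntegral
open scoped NNReal ENNReal
open Literature.MathematicalPhysics.KineticTheory.HeatConduction
open Literature.MathematicalPhysics.KineticTheory Literature.Probability.Process OscillatorChain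

/-! ## The registered stub -/

/-- **The coherent budget `S_N(t) + (2γ/T)∫₀ᵗ(r_N² + a_N²)` is non-increasing in `t`** (every chain of the family with
`β, γ > 0`, `lam ≥ 0`; every `N`): for `0 ≤ t₁ ≤ t₂`,
`S_N(t₂) + (2γ/T)∫_{(0,t₂]}(r_N² + a_N²) ≤ S_N(t₁) + (2γ/T)∫_{(0,t₁]}(r_N² + a_N²)` — the `L²(μ₀)` budget
`forecastBudget_timeResolved_of_sq_integrable'` at `F = v_{t₁}` with the forecast-norm term KEPT, Chapman–Kolmogorov
`K_s v_{t₁} = v_{s+t₁}`, and the translation `s ↦ s + t₁` on the time axis. [folklore] -/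
theorem coherentBudget_antitone : ∀ ω₂ lam β γ : ℝ, 0 < ω₂ → 0 ≤ lam → 0 < β → 0 < γ → ∀ T : ℝ, 0 < T → ∀ (N : ℕ) (t₁ t₂ : ℝ), 0 ≤ t₁ → t₁ ≤ t₂ → fnorm ω₂ lam β γ T N t₂ + (2 * γ / T) * ∫ s in Ioc (0 : ℝ) t₂, ((pairCorr ω₂ lam β γ T N s) ^ 2 + (∫ z, z.2 (Fin.last N) * fcast ω₂ lam β γ T N s z ∂((pinnedChain ω₂ lam β γ).gibbsMeasure (N + 1) T)) ^ 2) ≤ fnorm ω₂ lam β γ T N t₁ + (2 * γ / T) * ∫ s in Ioc (0 : ℝ) t₁, ((pairCorr ω₂ lam β γ T N s) ^ 2 + (∫ z, z.2 (Fin.last N) * fcast ω₂ lam β γ T N s z ∂((pinnedChain ω₂ lam β γ).gibbsMeasure (N + 1) T)) ^ 2) := by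
  intro ω₂ lam β γ hω hl hβ hγ T hT N t₁ t₂ h0 h12
  rcases h12.eq_or_lt with h | hlt
  · rw [h]
  set g : ℝ → ℝ := fun s => (pairCorr ω₂ lam β γ T N s) ^ 2 +
      (∫ z, z.2 (Fin.last N) * fcast ω₂ lam β γ T N s z ∂((pinnedChain ω₂ lam β γ).gibbsMeasure (N + 1) T)) ^ 2
    with hg
  have hg0 : ∀ s, 0 ≤ g s := fun s => add_nonneg (sq_nonneg _) (sq_nonneg _)
  have hgm : Measurable g :=
    ((Summit.AtomisticToContinuum.FouriersLaw.Theorems.IncoherentBounded.measurable_rN hω hl hβ hγ hT N).pow_const 2).add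
      ((measurable_aN hω hl hβ hγ hT N).pow_const 2)
  set t : ℝ := t₂ - t₁ with htdef
  have ht : 0 < t := by rw [htdef]; linarith
  have hγT : 0 ≤ 2 * γ / T := by positivity
  -- the `L²(μ₀)` budget at `F = v_{t₁}`, horizon `t`
  have hFm : Measurable (fcast ω₂ lam β γ T N t₁) := lightCone_measurable_fcast ω₂ lam β γ T N t₁
  have hF2 : Integrable (fun z => fcast ω₂ lam β γ T N t₁ z ^ 2) ((pinnedChain ω₂ lam β γ).gibbsMeasure (N + 1) T) :=
    (lightCone_fcast_moments ω₂ lam β γ hω hl hβ.le hγ.le T hT N t₁).2.1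
  have hbud := forecastBudget_timeResolved_of_sq_integrable' hω hl hβ hγ hT N hFm hF2 ht
  -- Chapman–Kolmogorov
  have hCK : ∀ s : ℝ, 0 ≤ s → ∀ x : PhaseSpace (N + 1),
      ∫ y, fcast ω₂ lam β γ T N t₁ y ∂((pinnedChain ω₂ lam β γ).transitionKernel (N + 1) T T s.toNNReal x) =
        fcast ω₂ lam β γ T N (s + t₁) x :=
    fun s hs x => (timeReversal_fcast_add hω hl hβ.le hγ.le hT N hs h0 x).symm
  have hnorm : ∫ x, (∫ y, fcast ω₂ lam β γ T N t₁ y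
        ∂((pinnedChain ω₂ lam β γ).transitionKernel (N + 1) T T t.toNNReal x)) ^ 2
        ∂((pinnedChain ω₂ lam β γ).gibbsMeasure (N + 1) T) = fnorm ω₂ lam β γ T N t₂ := by
    have e : t + t₁ = t₂ := by rw [htdef]; ring
    simp only [hCK t ht.le, e]
    rfl
  have heq : ∫⁻ s in Ioc (0 : ℝ) t, (ENNReal.ofReal ((∫ x, x.2 0 *
        (∫ y, fcast ω₂ lam β γ T N t₁ y ∂((pinnedChain ω₂ lam β γ).transitionKernel (N + 1) T T s.toNNReal x))
          ∂((pinnedChain ω₂ lam β γ).gibbsMeasure (N + 1) T)) ^ 2) +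
      ENNReal.ofReal ((∫ x, x.2 (Fin.last N) *
        (∫ y, fcast ω₂ lam β γ T N t₁ y ∂((pinnedChain ω₂ lam β γ).transitionKernel (N + 1) T T s.toNNReal x))
          ∂((pinnedChain ω₂ lam β γ).gibbsMeasure (N + 1) T)) ^ 2)) =
      ∫⁻ s in Ioc (0 : ℝ) t, ENNReal.ofReal (g (s + t₁)) := by
    refine setLIntegral_congr_fun measurableSet_Ioc fun s hs => ?_
    rw [hg]; dsimp only
    rw [ENNReal.ofReal_add (sq_nonneg _) (sq_nonneg _)]
    simp only [hCK s hs.1.le, pairCorr]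
  rw [hnorm, heq] at hbud
  -- the shifted lower integral is finite, hence an honest integral
  have hgsm : AEStronglyMeasurable (fun s => g (s + t₁)) (volume.restrict (Ioc (0 : ℝ) t)) :=
    (hgm.comp (measurable_id.add_const t₁)).aestronglyMeasurable
  have hI : ∫ s in Ioc (0 : ℝ) t, g (s + t₁) = (∫⁻ s in Ioc (0 : ℝ) t, ENNReal.ofReal (g (s + t₁))).toReal :=
    integral_eq_lintegral_of_nonneg_ae (ae_of_all _ fun s => hg0 _) hgsm
  have hfin : ∫⁻ s in Ioc (0 : ℝ) t, ENNReal.ofReal (g (s + t₁)) ≠ ∞ := by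
    intro hinf
    rw [hinf] at hbud
    have h1 : ENNReal.ofReal (2 * γ / T) * ∞ = ∞ := by
      rw [ENNReal.mul_top]; simp [ENNReal.ofReal_eq_zero, not_le.2 (by positivity : (0:ℝ) < 2 * γ / T)]
    rw [h1, add_top] at hbud
    exact absurd hbud (by simp)
  have hreal : fnorm ω₂ lam β γ T N t₂ + (2 * γ / T) * ∫ s in Ioc (0 : ℝ) t, g (s + t₁) ≤ fnorm ω₂ lam β γ T N t₁ := by
    have hI' : ENNReal.ofReal (∫ s in Ioc (0 : ℝ) t, g (s + t₁)) = ∫⁻ s in Ioc (0 : ℝ) t, ENNReal.ofReal (g (s + t₁)) := by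
      rw [hI, ENNReal.ofReal_toReal hfin]
    have hx0 : 0 ≤ ∫ s in Ioc (0 : ℝ) t, g (s + t₁) := integral_nonneg fun s => hg0 _
    rw [← hI', ← ENNReal.ofReal_mul hγT, ← ENNReal.ofReal_add (fnorm_nonneg ω₂ lam β γ T N t₂) (mul_nonneg hγT hx0)]
      at hbud
    exact (ENNReal.ofReal_le_ofReal_iff (fnorm_nonneg ω₂ lam β γ T N t₁)).1 hbud
  -- translate and split the time integral
  have hshift : ∫ s in Ioc (0 : ℝ) t, g (s + t₁) = ∫ s in Ioc t₁ t₂, g s := by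
    rw [← intervalIntegral.integral_of_le ht.le, intervalIntegral.integral_comp_add_right g t₁,
      zero_add, show t + t₁ = t₂ by rw [htdef]; ring, intervalIntegral.integral_of_le h12]
  have hgi : IntegrableOn g (Ioc (0 : ℝ) t₂) :=
    ((Summit.AtomisticToContinuum.FouriersLaw.Theorems.IncoherentBounded.rN_sq_integrableOn hω hl hβ hγ hT N).add
      (aN_sq_integrableOn hω hl hβ hγ hT N)).mono_set Ioc_subset_Ioi_self
  have hsplit : ∫ s in Ioc (0 : ℝ) t₂, g s = (∫ s in Ioc (0 : ℝ) t₁, g s) + ∫ s in Ioc t₁ t₂, g s := by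
    rw [← intervalIntegral.integral_of_le (h0.trans h12), ← intervalIntegral.integral_of_le h0,
      ← intervalIntegral.integral_of_le h12]
    exact (intervalIntegral.integral_add_adjacent_intervals
      ((intervalIntegrable_iff_integrableOn_Ioc_of_le h0).2 (hgi.mono_set (Ioc_subset_Ioc_right h12)))
      ((intervalIntegrable_iff_integrableOn_Ioc_of_le h12).2 (hgi.mono_set (Ioc_subset_Ioc_left h0)))).symm
  rw [hshift] at hreal
  rw [hsplit, mul_add]
  linarith

end Summit.AtomisticToContinuum.FouriersLaw.Theorems.PhononMeanFreePath

end
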